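import Mathlib
import Literature.NumberTheory.Transcendental.KZCalculusOver
import Summits.KontsevichZagierPeriods.KontsevichZagierPeriods.Theorems.SoloInformedProductOver
import Summits.KontsevichZagierPeriods.KontsevichZagierPeriods.Theorems.SoloInformedProductIdealOver
import Summits.KontsevichZagierPeriods.KontsevichZagierPeriods.Theorems.SoloInformedProductCommOver
import HarnessLib

/-!
# The commutative ring `P_k = KZ_k ⧸ relations k` and its evaluation `P_k →+* ℝ`

File of the solo-informed residency (s235), sequel of `SoloInformedProductOver`,
`SoloInformedProductIdealOver`, `SoloInformedProductCommOver`.  For every coefficient ring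
`k → ℝ` (`[CommRing k] [Algebra k ℝ]`):

* `soloInformedRingConOver k : RingCon (KZOver.FormalRep k)` — "differ by a relation" is a ring
  congruence for the Fubini product (`relations k` is a two-sided ideal);
* **`SoloInformedPeriodRingOver k := KZOver.FormalRep k ⧸ KZOver.relations k`** with
  `instCommRing` — the ring of formal periods with coefficients and parameters in `k`
  (unit `⟦[pt, 1]⟧`; the laws hold modulo relations by `SoloInformedProductCommOver`); as a type
  and as an additive group it IS the quotient `FormalRep k ⧸ relations k` used throughout the
  residency's `KZ_ℝ` files (`soloInformed_periodRingOver_eq_ringConQuotient` is `rfl`);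
* `soloInformedToPeriodOver k : FormalRep k →ₙ+* P_k`, the class map (`= QuotientAddGroup.mk`,
  `rfl`), `soloInformed_toPeriodOver_eq_iff`, `…_eq_zero_iff`, surjectivity, induction;
* **`soloInformedEvalPOver k : P_k →+* ℝ`**, `⟦c⟧ ↦ eval c` (well defined by soundness
  `KZOver.relations_le_ker_eval`, multiplicative by Fubini `soloInformed_evalOver_mul`);
  `P_k` is nontrivial;
* **`soloInformedPeriodRingBaseChange k k' : P_k →+* P_k'`** along a tower `k → k' → ℝ`
  (from `KZOver.baseChange`, multiplicative by `soloInformed_baseChangeOver_mul`), commuting with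
  evaluation (`soloInformed_evalPOver_baseChange`).

So Conjecture 1 over `k` reads: the RING homomorphism `soloInformedEvalPOver k` is injective
(`soloInformed_injective_evalPOver_iff`: iff `ker eval = relations k`).  Coefficient-generic form of
`KZ.FormalPeriodRing`, `KZ.toFormalPeriod`, `KZ.evalP` (`KZRulesAssociator.lean`, `k = ℚ`).
Bearing: residency verdict `paper/real-parameters.md` (S1) in kernel form — `P_ℝ` is a commutative
ring and `ev : P_ℝ → ℝ` a ring map; nothing here bears on Conjecture 1 itself.

References: M. Kontsevich, D. Zagier, *Periods* (2001), §1.2, §4.1.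
-/

noncomputable section

open Set MeasureTheory
open Literature.ModelTheory.ExponentialFields Literature.NumberTheory.Transcendental

namespace Summit.KontsevichZagierPeriods.KontsevichZagierPeriods.Theorems

section Generic

variable (k : Type*) [CommRing k] [Algebra k ℝ] {n m : ℕ}

/-! ### The ring congruence -/

/-- **"Differ by a relation" is a ring congruence on `KZ_k`** for the Fubini product: the
congruence of the additive subgroup `relations k`, multiplicative because `relations k` is a
two-sided ideal (`soloInformed_mul_sub_mul_mem_relationsOver`). -/
def soloInformedRingConOver : RingCon (KZOver.FormalRep k) where
  toSetoid := QuotientAddGroup.leftRel (KZOver.relations k)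
  add' := (QuotientAddGroup.con (KZOver.relations k)).add'
  mul' := fun {a b c d} hab hcd => by
    rw [QuotientAddGroup.leftRel_apply] at hab hcd ⊢
    rw [neg_add_eq_sub] at hab hcd ⊢
    exact soloInformed_mul_sub_mul_mem_relationsOver hab hcd

variable {k} in
/-- `soloInformedRingConOver k c d ↔ c − d ∈ relations k`. -/
theorem soloInformed_ringConOver_apply {c d : KZOver.FormalRep k} :
    soloInformedRingConOver k c d ↔ c - d ∈ KZOver.relations k := by
  change QuotientAddGroup.leftRel (KZOver.relations k) c d ↔ _
  rw [QuotientAddGroup.leftRel_apply, ← (KZOver.relations k).neg_mem_iff, neg_add', neg_neg]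

variable {k} in
/-- Two formal combinations have the same class iff they differ by a relation. -/
theorem soloInformed_ringConOver_coe_eq_coe_iff {c d : KZOver.FormalRep k} :
    ((c : KZOver.FormalRep k) : (soloInformedRingConOver k).Quotient) = (d : KZOver.FormalRep k) ↔
      c - d ∈ KZOver.relations k :=
  (RingCon.eq _).trans soloInformed_ringConOver_apply

variable {k} in
/-- Associativity of `*` in the quotient by the congruence. -/
theorem soloInformed_ringConQuotOver_mul_assoc (x y z : (soloInformedRingConOver k).Quotient) :
    x * y * z = x * (y * z) := by
  induction x using Quotient.inductionOn' with | h a => ?_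
  induction y using Quotient.inductionOn' with | h b => ?_
  induction z using Quotient.inductionOn' with | h c => ?_
  change ((a : KZOver.FormalRep k) : (soloInformedRingConOver k).Quotient) * (b : KZOver.FormalRep k)
      * (c : KZOver.FormalRep k) =
    ((a : KZOver.FormalRep k) : (soloInformedRingConOver k).Quotient) *
      ((b : KZOver.FormalRep k) * (c : KZOver.FormalRep k))
  rw [← RingCon.coe_mul, ← RingCon.coe_mul, ← RingCon.coe_mul, ← RingCon.coe_mul,
    soloInformed_ringConOver_coe_eq_coe_iff]
  exact soloInformed_mul_assoc_sub_mem_relationsOver a b c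

variable {k} in
/-- Commutativity of `*` in the quotient by the congruence. -/
theorem soloInformed_ringConQuotOver_mul_comm (x y : (soloInformedRingConOver k).Quotient) :
    x * y = y * x := by
  induction x using Quotient.inductionOn' with | h a => ?_
  induction y using Quotient.inductionOn' with | h b => ?_
  change ((a : KZOver.FormalRep k) : (soloInformedRingConOver k).Quotient) * (b : KZOver.FormalRep k) =
    ((b : KZOver.FormalRep k) : (soloInformedRingConOver k).Quotient) * (a : KZOver.FormalRep k)
  rw [← RingCon.coe_mul, ← RingCon.coe_mul, soloInformed_ringConOver_coe_eq_coe_iff]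
  exact soloInformed_mul_sub_mul_comm_mem_relationsOver a b

variable {k} in
/-- `⟦[pt, 1]⟧` is a left unit in the quotient by the congruence. -/
theorem soloInformed_ringConQuotOver_unit_mul (x : (soloInformedRingConOver k).Quotient) :
    ((KZOver.of soloInformedUnitOver : KZOver.FormalRep k) : (soloInformedRingConOver k).Quotient)
      * x = x := by
  induction x using Quotient.inductionOn' with | h a => ?_
  change ((KZOver.of soloInformedUnitOver : KZOver.FormalRep k) :
      (soloInformedRingConOver k).Quotient) * (a : KZOver.FormalRep k) = (a : KZOver.FormalRep k)
  rw [← RingCon.coe_mul, soloInformed_ringConOver_coe_eq_coe_iff]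
  exact soloInformed_ofUnitOver_mul_sub_mem_relations a

/-! ### The commutative ring `P_k` -/

/-- **The ring of formal periods over `k`**, `P_k := KZ_k ⧸ relations k` (as a type, the quotient of
the additive group `FormalRep k` by the subgroup `relations k`). -/
def SoloInformedPeriodRingOver : Type := KZOver.FormalRep k ⧸ KZOver.relations k

/-- `P_k` is, definitionally, the quotient of `FormalRep k` by the ring congruence
`soloInformedRingConOver k` (whose setoid is the coset relation of `relations k`). -/
theorem soloInformed_periodRingOver_eq_ringConQuotient :
    SoloInformedPeriodRingOver k = (soloInformedRingConOver k).Quotient := rfl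

/-- **`P_k` is a commutative ring**: `+`, `*`, distributivity from the ring congruence; unit
`⟦[pt, 1]⟧`; associativity, commutativity and the unit laws hold modulo relations
(`soloInformed_mul_assoc_sub_mem_relationsOver`, `soloInformed_mul_sub_mul_comm_mem_relationsOver`,
`soloInformed_ofUnitOver_mul_sub_mem_relations`). -/
instance SoloInformedPeriodRingOver.instCommRing : CommRing (SoloInformedPeriodRingOver k) where
  __ := (inferInstance : NonUnitalNonAssocRing (soloInformedRingConOver k).Quotient)
  one := ((KZOver.of soloInformedUnitOver : KZOver.FormalRep k) :
    (soloInformedRingConOver k).Quotient)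
  one_mul := soloInformed_ringConQuotOver_unit_mul
  mul_one x :=
    (soloInformed_ringConQuotOver_mul_comm _ _).trans (soloInformed_ringConQuotOver_unit_mul x)
  mul_assoc := soloInformed_ringConQuotOver_mul_assoc
  mul_comm := soloInformed_ringConQuotOver_mul_comm

/-- **The class map `KZ_k → P_k`**, `c ↦ ⟦c⟧`, a homomorphism of non-unital rings. -/
def soloInformedToPeriodOver : KZOver.FormalRep k →ₙ+* SoloInformedPeriodRingOver k where
  toFun c := ((c : KZOver.FormalRep k) : (soloInformedRingConOver k).Quotient)
  map_mul' _ _ := rfl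
  map_zero' := rfl
  map_add' _ _ := rfl

variable {k} in
/-- `soloInformedToPeriodOver k c` is the class of `c` for the ring congruence. -/
theorem soloInformed_toPeriodOver_apply (c : KZOver.FormalRep k) :
    soloInformedToPeriodOver k c = ((c : KZOver.FormalRep k) : (soloInformedRingConOver k).Quotient) :=
  rfl

variable {k} in
/-- `soloInformedToPeriodOver k c` is the coset of `c` in `FormalRep k ⧸ relations k`
(definitionally): the ring `P_k` sits on the additive quotient used elsewhere. -/
theorem soloInformed_toPeriodOver_eq_mk (c : KZOver.FormalRep k) :
    soloInformedToPeriodOver k c =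
      (QuotientAddGroup.mk c : KZOver.FormalRep k ⧸ KZOver.relations k) :=
  rfl

variable {k} in
/-- **`⟦c⟧ = ⟦d⟧ ↔ c − d ∈ relations k`.** -/
theorem soloInformed_toPeriodOver_eq_iff {c d : KZOver.FormalRep k} :
    soloInformedToPeriodOver k c = soloInformedToPeriodOver k d ↔ c - d ∈ KZOver.relations k :=
  soloInformed_ringConOver_coe_eq_coe_iff

variable {k} in
/-- **`⟦c⟧ = 0 ↔ c ∈ relations k`.** -/
theorem soloInformed_toPeriodOver_eq_zero_iff {c : KZOver.FormalRep k} :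
    soloInformedToPeriodOver k c = 0 ↔ c ∈ KZOver.relations k := by
  rw [← map_zero (soloInformedToPeriodOver k), soloInformed_toPeriodOver_eq_iff, sub_zero]

variable {k} in
/-- Equivalent representations have the same class in `P_k`. -/
theorem soloInformed_toPeriodOver_of_eq_of_equivalent {r : KZOver.IntegralRep k n}
    {r' : KZOver.IntegralRep k m} (h : KZOver.Equivalent r r') :
    soloInformedToPeriodOver k (KZOver.of r) = soloInformedToPeriodOver k (KZOver.of r') :=
  soloInformed_toPeriodOver_eq_iff.mpr h

/-- Every element of `P_k` is a class. -/
theorem soloInformed_toPeriodOver_surjective : Function.Surjective (soloInformedToPeriodOver k) :=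
  Quotient.mk''_surjective

/-- **`1 = ⟦[pt, 1]⟧` in `P_k`.** -/
theorem soloInformed_toPeriodOver_of_unitOver :
    soloInformedToPeriodOver k (KZOver.of soloInformedUnitOver) = 1 := rfl

variable {k} in
/-- `⟦[r]⟧ * ⟦[s]⟧ = ⟦[r × s]⟧`: on classes of representations the product of `P_k` is the Fubini
product. -/
theorem soloInformed_toPeriodOver_of_mul_of (r : KZOver.IntegralRep k n) (s : KZOver.IntegralRep k m) :
    soloInformedToPeriodOver k (KZOver.of r) * soloInformedToPeriodOver k (KZOver.of s) =
      soloInformedToPeriodOver k (KZOver.of (soloInformedProdOver r s)) := by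
  rw [← map_mul, soloInformed_ofOver_mul_ofOver]

variable {k} in
/-- **Induction on `P_k`**: a property holding at `0` and at the classes `⟦[r]⟧`, stable under
negation and addition, holds everywhere. -/
theorem soloInformed_periodRingOver_induction_on {p : SoloInformedPeriodRingOver k → Prop}
    (x : SoloInformedPeriodRingOver k) (zero : p 0)
    (hof : ∀ (n : ℕ) (r : KZOver.IntegralRep k n), p (soloInformedToPeriodOver k (KZOver.of r)))
    (neg : ∀ x, p x → p (-x)) (add : ∀ x y, p x → p y → p (x + y)) : p x := by
  obtain ⟨c, rfl⟩ := soloInformed_toPeriodOver_surjective k x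
  induction c using FreeAbelianGroup.induction_on with
  | zero => simpa using zero
  | of X => obtain ⟨n, r⟩ := X; exact hof n r
  | neg X ih => rw [map_neg]; exact neg _ ih
  | add X Y hX hY => rw [map_add]; exact add _ _ hX hY

/-! ### Evaluation `P_k →+* ℝ` -/

/-- **Evaluation of formal periods over `k`**, `⟦c⟧ ↦ eval c`, a ring homomorphism `P_k →+* ℝ`:
well defined by soundness (`KZOver.relations_le_ker_eval`), multiplicative by Fubini
(`soloInformed_evalOver_mul`), unital since `value [pt, 1] = 1`. -/
def soloInformedEvalPOver : SoloInformedPeriodRingOver k →+* ℝ where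
  toFun := Quotient.lift (KZOver.eval k : KZOver.FormalRep k → ℝ)
    fun a b (h : soloInformedRingConOver k a b) => by
      rw [soloInformed_ringConOver_apply] at h
      have h0 : KZOver.eval k (a - b) = 0 := KZOver.relations_le_ker_eval k h
      rwa [map_sub, sub_eq_zero] at h0
  map_one' := by
    change KZOver.eval k (KZOver.of soloInformedUnitOver) = 1
    rw [KZOver.eval_of, soloInformed_value_unitOver]
  map_mul' x y := by
    induction x using Quotient.inductionOn' with | h c => ?_
    induction y using Quotient.inductionOn' with | h d => ?_
    exact soloInformed_evalOver_mul k c d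
  map_zero' := by
    change KZOver.eval k (0 : KZOver.FormalRep k) = 0
    exact map_zero (KZOver.eval k)
  map_add' x y := by
    induction x using Quotient.inductionOn' with | h c => ?_
    induction y using Quotient.inductionOn' with | h d => ?_
    exact map_add (KZOver.eval k) c d

variable {k} in
/-- `evalP ⟦c⟧ = eval c`. -/
@[simp] theorem soloInformed_evalPOver_toPeriodOver (c : KZOver.FormalRep k) :
    soloInformedEvalPOver k (soloInformedToPeriodOver k c) = KZOver.eval k c := rfl

variable {k} in
/-- `evalP ⟦[r]⟧ = value r`. -/
theorem soloInformed_evalPOver_toPeriodOver_of (r : KZOver.IntegralRep k n) :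
    soloInformedEvalPOver k (soloInformedToPeriodOver k (KZOver.of r)) = r.value := by
  rw [soloInformed_evalPOver_toPeriodOver, KZOver.eval_of]

/-- **`P_k` is nontrivial**: `⟦[pt, 1]⟧ ≠ 0` since it evaluates to `1`. -/
instance SoloInformedPeriodRingOver.instNontrivial : Nontrivial (SoloInformedPeriodRingOver k) :=
  (soloInformedEvalPOver k).domain_nontrivial

/-- **Conjecture 1 over `k`, ring form**: the ring homomorphism `soloInformedEvalPOver k` is
injective iff every formal combination evaluating to `0` is a relation (`ker eval = relations k`). -/
theorem soloInformed_injective_evalPOver_iff :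
    Function.Injective (soloInformedEvalPOver k) ↔
      ∀ c : KZOver.FormalRep k, KZOver.eval k c = 0 → c ∈ KZOver.relations k := by
  rw [injective_iff_map_eq_zero]
  constructor
  · intro h c hc
    exact soloInformed_toPeriodOver_eq_zero_iff.mp (h (soloInformedToPeriodOver k c) hc)
  · intro h x hx
    obtain ⟨c, rfl⟩ := soloInformed_toPeriodOver_surjective k x
    exact soloInformed_toPeriodOver_eq_zero_iff.mpr (h c hx)

/-! ### Base change `P_k →+* P_k'` -/

variable (k' : Type*) [CommRing k'] [Algebra k' ℝ] [Algebra k k'] [IsScalarTower k k' ℝ]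

variable {k k'} in
/-- `[pt, 1]` over `k` base-changes to `[pt, 1]` over `k'`. -/
theorem soloInformed_unitOver_baseChange :
    (soloInformedUnitOver (k := k)).baseChange k' = soloInformedUnitOver (k := k') :=
  KZOver.IntegralRep.ext rfl rfl

/-- **Base change of formal periods along a tower `k → k' → ℝ`**, `⟦c⟧ ↦ ⟦c.baseChange k'⟧`, a
ring homomorphism `P_k →+* P_k'`: well defined since base change maps relations into relations
(`KZOver.map_baseChange_relations_le`), multiplicative (`soloInformed_baseChangeOver_mul`), unital
(`soloInformed_unitOver_baseChange`). -/
def soloInformedPeriodRingBaseChange :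
    SoloInformedPeriodRingOver k →+* SoloInformedPeriodRingOver k' where
  toFun := Quotient.lift
    (fun c => soloInformedToPeriodOver k' (KZOver.baseChange k k' c))
    fun a b (h : soloInformedRingConOver k a b) => by
      rw [soloInformed_ringConOver_apply] at h
      rw [soloInformed_toPeriodOver_eq_iff, ← map_sub]
      exact KZOver.baseChange_mem_relations k' h
  map_one' := by
    change soloInformedToPeriodOver k' (KZOver.baseChange k k' (KZOver.of soloInformedUnitOver)) = 1
    rw [KZOver.baseChange_of, soloInformed_unitOver_baseChange]
    rfl
  map_mul' x y := by
    induction x using Quotient.inductionOn' with | h c => ?_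
    induction y using Quotient.inductionOn' with | h d => ?_
    change soloInformedToPeriodOver k' (KZOver.baseChange k k' (c * d)) =
      soloInformedToPeriodOver k' (KZOver.baseChange k k' c) *
        soloInformedToPeriodOver k' (KZOver.baseChange k k' d)
    rw [soloInformed_baseChangeOver_mul, map_mul]
  map_zero' := by
    change soloInformedToPeriodOver k' (KZOver.baseChange k k' 0) = 0
    rw [map_zero, map_zero]
  map_add' x y := by
    induction x using Quotient.inductionOn' with | h c => ?_
    induction y using Quotient.inductionOn' with | h d => ?_
    change soloInformedToPeriodOver k' (KZOver.baseChange k k' (c + d)) =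
      soloInformedToPeriodOver k' (KZOver.baseChange k k' c) +
        soloInformedToPeriodOver k' (KZOver.baseChange k k' d)
    rw [map_add, map_add]

variable {k k'} in
/-- `baseChange ⟦c⟧ = ⟦c.baseChange k'⟧`. -/
@[simp] theorem soloInformed_periodRingBaseChange_toPeriodOver (c : KZOver.FormalRep k) :
    soloInformedPeriodRingBaseChange k k' (soloInformedToPeriodOver k c) =
      soloInformedToPeriodOver k' (KZOver.baseChange k k' c) := rfl

variable {k k'} in
/-- On the additive quotients, `soloInformedPeriodRingBaseChange k k'` is the map induced by
`KZOver.baseChange k k'` (`QuotientAddGroup.map`). -/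
theorem soloInformed_periodRingBaseChange_eq_map (x : SoloInformedPeriodRingOver k) :
    soloInformedPeriodRingBaseChange k k' x =
      (QuotientAddGroup.map (KZOver.relations k) (KZOver.relations k') (KZOver.baseChange k k')
        (fun _ hc => KZOver.baseChange_mem_relations k' hc) x :
        KZOver.FormalRep k' ⧸ KZOver.relations k') := by
  induction x using Quotient.inductionOn' with | h c => ?_
  rfl

variable {k k'} in
/-- **Base change commutes with evaluation**: `evalP (baseChange x) = evalP x`. -/
@[simp] theorem soloInformed_evalPOver_baseChange (x : SoloInformedPeriodRingOver k) :
    soloInformedEvalPOver k' (soloInformedPeriodRingBaseChange k k' x) = soloInformedEvalPOver k x := by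
  induction x using Quotient.inductionOn' with | h c => ?_
  exact KZOver.eval_baseChange k' c

end Generic

end Summit.KontsevichZagierPeriods.KontsevichZagierPeriods.Theorems
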